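import Summits.BirchSwinnertonDyer.Rank1Residual.X10.UnitRoad
import Summits.BirchSwinnertonDyer.Rank1Residual.Iwasawa.SelmerCardOfLevelZeroControlTamagawa
import Summits.BirchSwinnertonDyer.Rank1Residual.Iwasawa.LocalTowerKernelAtPGoodOrdinary
import HarnessLib

/-!
# Class X10b (N2), the UNIT ROAD at `p = 3` WITHOUT Kato 17.4 and WITHOUT Greenberg's Thm. 4.1:
# `X(E/ℚ_∞) = 0` by Greenberg's Prop. 3.8 PROVED IN THE TREE, hence Mazur's main conjecture with
# `μ = 0` AT THE PAIR for every cell with trivial `3`-primary arithmetic, the period unit `h3` being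
# the ONLY named fact left (cell `b2b-bsdres`, unit `b2b-bsdres-x10` = N2 class lead, gen 26)

HONEST FRAMING (run/shared/lean/b2b/bsd-rank1-residual/, verbatim in every file): the goal of the
cell is to DELETE the COMBINATION-SHAPED residual classes of the Birch–Swinnerton-Dyer formula for
ALL analytic-rank `≤ 1` elliptic curves over `ℚ` — "full BSD formula for every rank `≤ 1` curve in
class `C`" assembled STRICTLY from published theorems — so that the rank-`≤ 1` remainder becomes
exactly the CONSTRUCTION-SHAPED classes, which are TYPED (missing-input `Prop`s), NOT attempted.
This is not "finishing BSD". Theorems only; NO definition, NO named fact is introduced; class X10b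
(`p = 3` good ordinary, `E[3]` irreducible, `ρ̄_{E,3}` onto a Cartan normaliser) keeps its label
CONSTRUCTION-SHAPED (NEEDS X_A3 = `MazurMainConjecture W 3`, referee R82.3 / RESIDUAL-MAP §I N2);
nothing is booked by this file; everything is PER PAIR.

## What this file adds (x10 GEN 26, X10-AUDIT §32)

The unit road of GEN 24 (`X10/UnitRoad`, = x9 gen 5's
`Rank1Residual.mazurMainConjecture_with_mu_zero_of_trivialArithmetic_odd`) proves Mazur's main
conjecture at `(E,3)` for a cell with TRIVIAL `3`-primary arithmetic (`3` good ordinary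
NON-ANOMALOUS, `E[3]` irreducible, `3 ∤ ∏ c_ℓ`, `L(E,1)/Ω_E` a `3`-adic unit, `Sel_{3^∞}(E/ℚ) = 0`)
from FOUR published named facts: Kato 2004 Thm. 17.4 (1) (`hkato`: `X(E/ℚ_∞)` is `Λ`-torsion),
Greenberg 1999 Thm. 4.1 (`hGr`: the Euler-characteristic formula, to see that the generator of
`char X` is a unit), and the period unit (`h5` at `p ≥ 5`, `h3` at `p = 3`). The first two are
used ONLY to show `char_Λ X(E/ℚ_∞) = Λ`. But at such a cell `X(E/ℚ_∞)` is ZERO OUTRIGHT by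
Greenberg's Prop. 3.8 (LNM 1716, p. 95: `Sel_E(ℚ)_p = 0`, `p ∤ #Ẽ(𝔽_p)`, `p ∤ c_ℓ` for all `ℓ`
⟹ `Sel_E(ℚ_∞)_p = 0`), and Prop. 3.8 is now a THEOREM OF THE TREE: team n1011 (seat p06)
`Iwasawa.subsingleton_X_of_card_selmer_eq_one_of_not_dvd_localTamagawaNumber` (the level-`0`
control skeleton with Greenberg's SHARP local sockets `p ∤ c_v ⟹ 𝒦_{v,0}[p^∞] = ⊥`, Lemma 3.3) and
`Iwasawa.GoodOrdinary.localTowerKerPrimary_zero_eq_bot_of_goodOrdinary_nonAnomalous` (the socket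
above `p`, Lemma 3.4 / Prop. 3.8 (i)). THIS FILE composes them:

* §0 `subsingleton_dualSelmer_of_trivialArithmetic` — **`X(E/ℚ_∞) = 0`** for `E` good ordinary
  non-anomalous at ANY prime `p` with `p ∤ ∏ c_ℓ(E)` and `#Sel_{p^∞}(E/ℚ) = 1` (the finite set of
  places over `p · Δ_min` built inside; `c_v ∣ ∏ c_ℓ`); NO named fact at all.
* §1 `exists_unitGenerator_of_charIdeal_eq_top` — the ANALYTIC half of x9 gen 5's proof, isolated:
  `char X = Λ`, `p` odd good ordinary non-anomalous, `E[p]` irreducible (integrality of `L_p`, tree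
  theorem), `L(E,1)/Ω_E` a `p`-adic unit and `‖ϖ‖_p = 1` ⟹ `char X = (G)`, `G` of unit content,
  `ι G = ϖ · L_p(f, α)`; `norm_periodRatio_eq_one_three` — `‖ϖ‖₃ = 1` from `h3` ALONE.
* §2 `mazurMainConjecture_with_mu_zero_of_trivialArithmetic_odd_prop38` (odd `p`; named facts `h5`,
  `h3` only) and `…_three_prop38` (`p = 3`; named fact `h3` ONLY); `mazurMainConjecture_three_prop38`
  (the cell's typed input X_A3 at the pair, `MazurMainConjecture W 3`).
* the integer-model consumers of `X10/UnitRoad` §1–§2 (unit road, trivial-partner road) re-issued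
  WITHOUT `hkato`, `hGr`, `h5` are the sibling file `X10/UnitRoadProp38IntModel.lean`.

Consequence for the N2 census (per pair, nothing booked): on the 77 UNIT cells of record the
displayed binders of X_A3-at-the-pair drop from {PUBLISHED `hkato`, `hGr`, `h5`, `h3`; census `hL`,
`hSel`} (GEN 25, `htam` kernel-discharged) to {PUBLISHED `h3`; census `hL`, `hSel`} — records in the
sibling files `X10/UnitRoadProp38Records*.lean`. Where '3' enters: nowhere new (Prop. 3.8 has no
parity condition; `p ≠ 2` is used only on the analytic side, as before).

References: R. Greenberg, LNM 1716 (1999) Prop. 3.8 and Remark (pp. 95–96), Lemma 3.3 (p. 87),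
Lemma 3.4 (p. 89) [GreenbergLNM1716]; R. Greenberg, V. Vatsal, Invent. Math. 142 (2000) §1 and §3
Remark (3.4), Prop. (3.7) [GreenbergVatsal2000]; B. Mazur, Invent. Math. 44 (1978) Cor. 4.1, Prop.
6.3 (1) [Mazur1978]; cell files X10-AUDIT.md §32, `class-closure/N2/LAMBDA-SUBPARTITION-x10g24.md`.
-/

set_option autoImplicit false

noncomputable section

open scoped Classical MatrixGroups ModularForm

open CongruenceSubgroup WeierstrassCurve Literature.NumberTheory.EllipticCurves
  Literature.NumberTheory.EllipticCurves.ModularForms Literature.NumberTheory.EllipticCurves.Rank1Residual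
  Literature.NumberTheory.EllipticCurves.Rank1Residual.X11RankOneCertificates
  Summit.BirchSwinnertonDyer.BirchSwinnertonDyer.Rank1Residual.IntModel
  Summit.BirchSwinnertonDyer.BirchSwinnertonDyer.Rank1Residual.X11RankOne
  Summit.BirchSwinnertonDyer.BirchSwinnertonDyer.Theorems.Rank1ResidualX1Defs
  NumberField IsDedekindDomain Rat.HeightOneSpectrum

namespace Summit.BirchSwinnertonDyer.Rank1Residual.X10.UnitRoad

/-! ### §0. `X(E/ℚ_∞) = 0` at a good ordinary non-anomalous prime with `p ∤ ∏ c_ℓ`, `Sel_{p^∞} = 0` -/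

/-- The finite set of places of `ℚ` over the prime factors of a natural number `n` (membership:
`primesEquiv v ∈ n.primeFactors`). [folklore] -/
theorem exists_placeFinset_primeFactors (n : ℕ) :
    ∃ S : Finset (HeightOneSpectrum (𝓞 ℚ)),
      ∀ v : HeightOneSpectrum (𝓞 ℚ), v ∈ S ↔ (primesEquiv v : ℕ) ∈ n.primeFactors := by
  set e := primesEquiv (R := 𝓞 ℚ) with he
  refine ⟨n.primeFactors.attach.image fun q ↦ e.symm ⟨q.1, Nat.prime_of_mem_primeFactors q.2⟩,
    fun v ↦ ?_⟩
  rw [Finset.mem_image]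
  constructor
  · rintro ⟨q, -, hqv⟩
    rw [← hqv, Equiv.apply_symm_apply]
    exact q.2
  · intro hv
    refine ⟨⟨(e v : ℕ), hv⟩, Finset.mem_attach _ _, ?_⟩
    rw [Equiv.symm_apply_eq]
    exact Subtype.ext rfl

/-- **`X(E/ℚ_∞) = 0` for a curve with trivial `p`-primary arithmetic — NO named fact.** For a
globally minimal elliptic `A/ℚ`, ANY prime `p` of good ORDINARY, NON-ANOMALOUS reduction
(`p ∤ a_p`, `p ∤ #Ã(𝔽_p)`) with `p ∤ ∏_ℓ c_ℓ(A)` and `#Sel_{p^∞}(A/ℚ) = 1`, the cyclotomic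
`ℤ_p`-extension `κ` with topological generator `γ` and any Pontryagin-dual datum `D`: `X(A/ℚ_∞) = 0`.
Greenberg's Prop. 3.8 as PROVED in the tree (n1011-p06): the level-`0` control skeleton
`Iwasawa.subsingleton_X_of_card_selmer_eq_one_of_not_dvd_localTamagawaNumber` with the sharp socket
`p ∤ c_v` at the places `v ∤ p` over `p · Δ_min` (each `c_v` divides `∏ c_ℓ`,
`Iwasawa.tamagawaProduct_eq_prod_of_good`) and the good-ordinary non-anomalous socket above `p`
(`Iwasawa.GoodOrdinary.localTowerKerPrimary_zero_eq_bot_of_goodOrdinary_nonAnomalous`); off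
`p · Δ_min` every place is good (Silverman VII.5.1 (a)). No Kato, no Greenberg 4.1, no period.
[cite: GreenbergLNM1716, §3 Prop. 3.8 and Remark (pp. 95–96), Lemma 3.3 (p. 87), Lemma 3.4 (p. 89)] -/
theorem subsingleton_dualSelmer_of_trivialArithmetic
    (A : WeierstrassCurve ℚ) [A.IsElliptic] [A.IsGloballyMinimal] (p : ℕ) [Fact p.Prime]
    (hgood : A.HasGoodReductionAtPrime p) (hord : ¬ (p : ℤ) ∣ A.frobeniusTrace p)
    (hna : ¬ p ∣ A.reductionPointCount p) (htam : ¬ p ∣ A.tamagawaProduct)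
    (hSel : Nat.card (A.selmerGroupPInfty p) = 1)
    {κ : ZpExtension ℚ p} {γ : Field.absoluteGaloisGroup ℚ} (hκ : κ.IsCyclotomic)
    (hγ : κ.IsTopGenerator γ) (D : A.SelmerDualData κ γ) : Subsingleton D.X := by
  have hpP : p.Prime := Fact.out
  have hΔ : ¬ (p : ℤ) ∣ minimalDiscriminantInt A :=
    not_dvd_minimalDiscriminantInt_of_hasGoodReductionAtPrime A p hgood
  -- the finite set of places over `p · Δ_min`
  have hΔ0 : minimalDiscriminantInt A ≠ 0 := fun h ↦ hΔ (by rw [h]; exact dvd_zero _)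
  have hn0 : p * (minimalDiscriminantInt A).natAbs ≠ 0 :=
    mul_ne_zero hpP.ne_zero (Int.natAbs_ne_zero.mpr hΔ0)
  obtain ⟨S, hS⟩ := exists_placeFinset_primeFactors (p * (minimalDiscriminantInt A).natAbs)
  -- off `S`: prime to `p` and good
  have hoff : ∀ v ∉ S, (p : 𝓞 ℚ) ∉ v.asIdeal ∧ A.HasGoodReductionAt v := by
    intro v hv
    have hqP : (primesEquiv v : ℕ).Prime := (primesEquiv v).2
    have hqn : ¬ (primesEquiv v : ℕ) ∣ p * (minimalDiscriminantInt A).natAbs :=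
      fun h ↦ hv ((hS v).mpr (Nat.mem_primeFactors.mpr ⟨hqP, h, hn0⟩))
    refine ⟨fun hpv ↦ hqn ?_, ?_⟩
    · rw [primesEquiv_eq_of_natCast_mem v hpP hpv]
      exact dvd_mul_right p _
    · haveI : Fact (primesEquiv v : ℕ).Prime := ⟨hqP⟩
      refine (hasGoodReductionAtPrime_iff_hasGoodReductionAt_ringOfIntegers v A).mp
        (hasGoodReductionAtPrime_of_not_dvd A _ fun h ↦ hqn (Dvd.dvd.mul_left ?_ p))
      have h' := Int.natAbs_dvd_natAbs.mpr h
      rwa [Int.natAbs_natCast] at h'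
  -- on `S` away from `p`: `p ∤ c_v`, since `c_v ∣ ∏ c_ℓ`
  have hSc : ∀ v ∈ S, (p : 𝓞 ℚ) ∉ v.asIdeal →
      ¬ p ∣ (A.baseChange (v.adicCompletion ℚ)).localTamagawaNumber (v.adicCompletionIntegers ℚ) := by
    intro v hv _ hpc
    refine htam (hpc.trans ?_)
    rw [Iwasawa.tamagawaProduct_eq_prod_of_good A S fun w hw ↦ (hoff w hw).2]
    exact Finset.dvd_prod_of_mem _ hv
  -- on `S` above `p`: the good ordinary non-anomalous socket
  have hSp : ∀ v ∈ S, (p : 𝓞 ℚ) ∈ v.asIdeal →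
      A.localTowerKerPrimary κ (v.adicCompletion ℚ) 0 = ⊥ :=
    fun v _ hpv ↦ Iwasawa.GoodOrdinary.localTowerKerPrimary_zero_eq_bot_of_goodOrdinary_nonAnomalous
      A p hpv hΔ hord hna κ hκ
  exact Iwasawa.subsingleton_X_of_card_selmer_eq_one_of_not_dvd_localTamagawaNumber A κ D hγ hSel S
    hSc hSp hoff

/-! ### §1. The analytic half: `char X = Λ` ⟹ a generator of unit content interpolating `ϖ · L_p` -/

/-- **The analytic half of the unit road, isolated (x9 gen 5's Steps 3–4).** For a globally minimal
elliptic `A/ℚ`, an ODD prime `p` of good ORDINARY NON-ANOMALOUS reduction with `A[p]` irreducible,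
`L(A,1)/Ω_A` a non-zero rational `p`-adic unit, a newform `f` of `A`, a rational `ϖ` with
`ϖ · Ω_A = Ω⁺_f` and `‖ϖ‖_p = 1`, and a dual datum `D` with `char_Λ X = Λ`: there is `G ∈ Λ` with
`char_Λ X = (G)`, `G` of unit content, `ι G = ϖ · L_p(f, α)`. Proof: `G := ϖ · L_p(f, α)` has
coefficients in `ℤ_p` (integrality for irreducible `A[p]`, tree theorem
`padicLFunction_mem_integral_holds`, Greenberg–Vatsal Prop. 3.7) and
`G(0) = ϖ (1 − α⁻¹)² [0]⁺_f = (1 − α⁻¹)² · L(A,1)/Ω_A` is a unit (`1 − α⁻¹ ∼ #Ã(𝔽_p)`, non-anomalous).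
No named fact. [cite: GreenbergVatsal2000, Prop. (3.7) and §1] [cite: MazurTateTeitelbaum1986, §I.14] -/
theorem exists_unitGenerator_of_charIdeal_eq_top
    (A : WeierstrassCurve ℚ) [A.IsElliptic] [A.IsGloballyMinimal] (p : ℕ) [Fact p.Prime]
    (hp2 : p ≠ 2) (hgood : A.HasGoodReductionAtPrime p) (hord : ¬ (p : ℤ) ∣ A.frobeniusTrace p)
    (hirr : A.HasIrreducibleModPGaloisRep p) (hna : ¬ p ∣ A.reductionPointCount p)
    (hL : ∃ q : ℚ, q ≠ 0 ∧ A.entireLFunction 1 / (A.realPeriodRat : ℂ) = (q : ℂ) ∧ padicValRat p q = 0)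
    {N : ℕ} [NeZero N] (fA : CuspForm (Gamma0 N) 2) (hf : IsNewformOf A fA) (ϖ : ℚ)
    (hϖnorm : ‖(ϖ : ℚ_[p])‖ = 1) (hϖeq : (ϖ : ℝ) * A.realPeriodRat = plusPeriod fA)
    {κ : ZpExtension ℚ p} {γ : Field.absoluteGaloisGroup ℚ} (D : A.SelmerDualData κ γ)
    (hchar_top : D.charIdeal = ⊤) :
    ∃ g : IwasawaAlgebra p, D.charIdeal = Ideal.span {g} ∧
      GreenbergVatsal2000.HasUnitContent g ∧
      iwasawaToPowerSeries p g =
        PowerSeries.C (ϖ : ℚ_[p]) * padicLFunction fA (unitRoot A p : ℚ_[p]) := by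
  have hpP : p.Prime := Fact.out
  have hordp : IsOrdinaryAt A p := ⟨hgood, hord⟩
  haveI : NeZero p := ⟨hpP.ne_zero⟩
  -- the rational number `t = ϖ · [0]⁺ = L(A,1)/Ω_A` and its valuation
  obtain ⟨q, hq0, hqeq, hqv⟩ := hL
  set s : ℚ := ratPlusSymbol fA 0 with hs_def
  have hΩpos : 0 < A.realPeriodRat := A.realPeriodRat_pos_holds
  have hLval : A.entireLFunction 1 = (((s : ℝ) * plusPeriod fA : ℝ) : ℂ) := hf.entireLFunction_one_eq
  have ht : A.entireLFunction 1 / (A.realPeriodRat : ℂ) = ((ϖ * s : ℚ) : ℂ) := by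
    rw [hLval, ← hϖeq, div_eq_iff (Complex.ofReal_ne_zero.mpr hΩpos.ne')]
    push_cast
    ring
  have hqt : q = ϖ * s := by
    have h := hqeq.symm.trans ht
    exact_mod_cast h
  -- `#Ã(𝔽_p) = u₃ · #Ã(𝔽_p)[p^∞]`, a unit
  obtain ⟨u₃, hu₃⟩ := exists_unit_natCard_eq_mul_card_primaryComponent
    ((integralModelInt A).map (Int.castRingHom (ZMod p))).toAffine.Point p
  set Np : ℚ_[p] := (Nat.card (AddCommGroup.primaryComponent
    ((integralModelInt A).map (Int.castRingHom (ZMod p))).toAffine.Point p) : ℚ_[p]) with hNp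
  have hNcount : (A.reductionPointCount p : ℚ_[p]) = ((u₃ : ℤ_[p]) : ℚ_[p]) * Np := by
    rw [WeierstrassCurve.reductionPointCount, hNp]
    exact hu₃
  have hNp0 : Np ≠ 0 := by rw [hNp]; exact_mod_cast Nat.card_pos.ne'
  have hvNp : Np.valuation = 0 := by
    have h := congrArg Padic.valuation hNcount
    rw [Padic.valuation_natCast, Padic.valuation_mul (coe_units_ne_zero p u₃) hNp0,
      valuation_coe_units_eq_zero, zero_add, padicValNat.eq_zero_of_not_dvd hna] at h
    exact_mod_cast h.symm
  -- Step 3 (integrality): `G := ϖ · L_p(f_A, α) ∈ Λ`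
  set L := padicLFunction fA (unitRoot A p : ℚ_[p]) with hLdef
  have hcoef : ∀ n : ℕ, ‖PowerSeries.coeff n (PowerSeries.C (ϖ : ℚ_[p]) * L)‖ ≤ 1 := by
    intro n
    rw [PowerSeries.coeff_C_mul, norm_mul, hϖnorm, one_mul, hLdef, coeff_padicLFunction]
    exact padicLFunction_mem_integral_holds hp2 hordp hf hirr n
  set G : IwasawaAlgebra p := PowerSeries.mk fun n =>
    (⟨PowerSeries.coeff n (PowerSeries.C (ϖ : ℚ_[p]) * L), hcoef n⟩ : ℤ_[p]) with hGdef
  have hιG : iwasawaToPowerSeries p G = PowerSeries.C (ϖ : ℚ_[p]) * L := by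
    ext n
    rw [iwasawaToPowerSeries, PowerSeries.coeff_map, hGdef, PowerSeries.coeff_mk]
    rfl
  -- Step 4 (interpolation): `G(0) = ϖ (1 - α⁻¹)² [0]⁺_{f_A}` is a unit
  set a : ℚ_[p] := ((unitRoot A p : ℤ_[p]) : ℚ_[p]) with ha
  obtain ⟨u₂, hu₂⟩ := exists_unit_one_sub_unitRoot_inv p A hordp
  have h1a : (1 - a⁻¹) = ((u₂ : ℤ_[p]) : ℚ_[p]) * ((u₃ : ℤ_[p]) : ℚ_[p]) * Np := by
    rw [ha, hu₂, hNcount, mul_assoc]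
  have h1a0 : (1 - a⁻¹) ≠ 0 := by
    rw [h1a]; exact mul_ne_zero (mul_ne_zero (coe_units_ne_zero p u₂) (coe_units_ne_zero p u₃)) hNp0
  have hv1a : (1 - a⁻¹).valuation = 0 := by
    rw [h1a, Padic.valuation_mul (mul_ne_zero (coe_units_ne_zero p u₂) (coe_units_ne_zero p u₃)) hNp0,
      Padic.valuation_mul (coe_units_ne_zero p u₂) (coe_units_ne_zero p u₃),
      valuation_coe_units_eq_zero, valuation_coe_units_eq_zero, hvNp, add_zero, add_zero]
  have htQ0 : ((q : ℚ) : ℚ_[p]) ≠ 0 := by exact_mod_cast hq0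
  have hG0 : ((PowerSeries.constantCoeff G : ℤ_[p]) : ℚ_[p]) = (1 - a⁻¹) ^ 2 * (q : ℚ_[p]) := by
    rw [← constantCoeff_iwasawaToPowerSeries p G, hιG, map_mul, PowerSeries.constantCoeff_C, hLdef,
      constantCoeff_padicLFunction_unitRoot hordp hf, hqt]
    push_cast
    rw [ha]
    ring
  have hG00 : ((PowerSeries.constantCoeff G : ℤ_[p]) : ℚ_[p]) ≠ 0 := by
    rw [hG0]; exact mul_ne_zero (pow_ne_zero 2 h1a0) htQ0
  have hvG0 : ((PowerSeries.constantCoeff G : ℤ_[p]) : ℚ_[p]).valuation = 0 := by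
    rw [hG0, Padic.valuation_mul (pow_ne_zero 2 h1a0) htQ0, Padic.valuation_pow, hv1a,
      Padic.valuation_ratCast, hqv]
    simp
  have hG0unit : IsUnit (PowerSeries.constantCoeff G) := isUnit_of_valuation_coe_eq_zero _ hG00 hvG0
  have hGunit : IsUnit G := PowerSeries.isUnit_iff_constantCoeff.mpr hG0unit
  refine ⟨G, ?_, ⟨0, ?_⟩, hιG⟩
  · rw [hchar_top, eq_comm, Ideal.span_singleton_eq_top]; exact hGunit
  · rw [PowerSeries.coeff_zero_eq_constantCoeff]; exact hG0unit

/-- **`‖ϖ‖₃ = 1` from the period unit at `p = 3` ALONE** (`h3`: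
`realPeriodRat_eq_unit_mul_plusPeriod_three`, Greenberg–Vatsal 2000 §3 Remark (3.4) with Mazur 1978
Cor. 4.1 for the Manin constant at `3 ∤ N`): for a globally minimal elliptic `A/ℚ` good at `3` with
`A[3]` irreducible, a newform `f` of `A` and `ϖ · Ω_A = Ω⁺_f`, `ϖ` is a `3`-adic unit (`Ω_A = u Ω⁺_f`
with `u` a `3`-adic unit, so `ϖ u = 1`). The `p = 3` case of x9 gen 5's `norm_periodRatio_eq_one_of_odd`
without its `p ≥ 5` binder `h5`. [cite: GreenbergVatsal2000, §3 Remark (3.4)] [cite: Mazur1978, Cor. 4.1] -/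
theorem norm_periodRatio_eq_one_three (h3 : realPeriodRat_eq_unit_mul_plusPeriod_three)
    (A : WeierstrassCurve ℚ) [A.IsElliptic] [A.IsGloballyMinimal] [Fact (Nat.Prime 3)]
    (hgood : A.HasGoodReductionAtPrime 3) (hirr : A.HasIrreducibleModPGaloisRep 3)
    {N : ℕ} [NeZero N] (f : CuspForm (Gamma0 N) 2) (hf : IsNewformOf A f) (ϖ : ℚ)
    (hϖeq : (ϖ : ℝ) * A.realPeriodRat = plusPeriod f) : ‖(ϖ : ℚ_[3])‖ = 1 := by
  have hplus : plusPeriod f ≠ 0 := (IsNewform0.plusPeriod_pos_holds hf.1 hf.coeffField_eq_bot).ne'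
  obtain ⟨u, hu1, huΩ⟩ := h3 A hgood hirr f hf
  have hϖu : ϖ * u = 1 := by
    have h1 : ((ϖ * u : ℚ) : ℝ) * plusPeriod f = ((1 : ℚ) : ℝ) * plusPeriod f := by
      calc ((ϖ * u : ℚ) : ℝ) * plusPeriod f = (ϖ : ℝ) * ((u : ℝ) * plusPeriod f) := by
            push_cast; ring
        _ = (ϖ : ℝ) * A.realPeriodRat := by rw [← huΩ]
        _ = plusPeriod f := hϖeq
        _ = ((1 : ℚ) : ℝ) * plusPeriod f := by push_cast; rw [one_mul]
    exact_mod_cast mul_right_cancel₀ hplus h1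
  have h := congrArg (fun r : ℚ => ‖(r : ℚ_[3])‖) hϖu
  simp only [Rat.cast_mul, norm_mul, hu1, mul_one, Rat.cast_one, norm_one] at h
  exact h

/-! ### §2. Mazur's main conjecture with `μ = 0` at the pair, Kato- and Greenberg-4.1-free -/

/-- **Trivial `p`-primary arithmetic ⟹ Mazur's main conjecture with `μ = 0` at every ODD good
ordinary prime with `A[p]` irreducible — WITHOUT Kato 17.4 and WITHOUT Greenberg's Thm. 4.1.** Same
hypotheses and conclusion as x9 gen 5's `mazurMainConjecture_with_mu_zero_of_trivialArithmetic_odd`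
MINUS the binders `hkato`, `hGr`: the algebraic side is `X(A/ℚ_∞) = 0` (§0, Greenberg's Prop. 3.8 in
the tree), so `X` is torsion and `char X = Λ` for free; the analytic side is §1. Named facts left:
the period unit `h5` (`p ≥ 5`) / `h3` (`p = 3`). Per pair; no class statement; nothing booked.
[cite: GreenbergLNM1716, §3 Prop. 3.8 and Remark (pp. 95–96)] [cite: GreenbergVatsal2000, §1, §3 Remark (3.4), Prop. (3.7)] -/
theorem mazurMainConjecture_with_mu_zero_of_trivialArithmetic_odd_prop38
    (h5 : realPeriodRat_eq_unit_mul_plusPeriod) (h3 : realPeriodRat_eq_unit_mul_plusPeriod_three)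
    (A : WeierstrassCurve ℚ) [A.IsElliptic] [A.IsGloballyMinimal] (p : ℕ) [Fact p.Prime]
    (hp2 : p ≠ 2) (hgood : A.HasGoodReductionAtPrime p) (hord : ¬ (p : ℤ) ∣ A.frobeniusTrace p)
    (hirr : A.HasIrreducibleModPGaloisRep p)
    (hna : ¬ p ∣ A.reductionPointCount p) (htam : ¬ p ∣ A.tamagawaProduct)
    (hL : ∃ q : ℚ, q ≠ 0 ∧ A.entireLFunction 1 / (A.realPeriodRat : ℂ) = (q : ℂ) ∧ padicValRat p q = 0)
    (hSel : Nat.card (A.selmerGroupPInfty p) = 1) :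
    ∀ (κ : ZpExtension ℚ p) (γ : Field.absoluteGaloisGroup ℚ),
        κ.IsCyclotomic → κ.IsTopGenerator γ → IsCyclotomicVariable p γ →
      ∀ [NeZero (A.conductorNorm ℤ)] (fA : CuspForm (Gamma0 (A.conductorNorm ℤ)) 2),
        IsNewformOf A fA → ∀ (ϖ : ℚ), (ϖ : ℝ) * A.realPeriodRat = plusPeriod fA →
      ∀ (D : A.SelmerDualData κ γ), D.IsTorsion ∧
        ∃ g : IwasawaAlgebra p, D.charIdeal = Ideal.span {g} ∧
          GreenbergVatsal2000.HasUnitContent g ∧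
          iwasawaToPowerSeries p g =
            PowerSeries.C (ϖ : ℚ_[p]) * padicLFunction fA (unitRoot A p : ℚ_[p]) := by
  intro κ γ hκ hγ _ _ fA hf ϖ hϖeq D
  haveI := subsingleton_dualSelmer_of_trivialArithmetic A p hgood hord hna htam hSel hκ hγ D
  exact ⟨Iwasawa.isTorsion_of_subsingleton D,
    exists_unitGenerator_of_charIdeal_eq_top A p hp2 hgood hord hirr hna hL fA hf ϖ
      (norm_periodRatio_eq_one_of_odd h5 h3 A p hp2 hgood hirr fA hf ϖ hϖeq) hϖeq D
      (Iwasawa.charIdeal_eq_top_of_subsingleton D)⟩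

/-- **Trivial `3`-primary arithmetic ⟹ Mazur's main conjecture with `μ = 0` at `p = 3` — the period
unit `h3` the ONLY named fact.** As `mazurMainConjecture_with_mu_zero_of_trivialArithmetic_odd_prop38`
at `p = 3`, with `‖ϖ‖₃ = 1` from `norm_periodRatio_eq_one_three` (no `h5`). Per pair; nothing booked.
[cite: GreenbergLNM1716, §3 Prop. 3.8 and Remark (pp. 95–96)] [cite: GreenbergVatsal2000, §1, §3 Remark (3.4), Prop. (3.7)]
[cite: Mazur1978, Cor. 4.1] -/
theorem mazurMainConjecture_with_mu_zero_of_trivialArithmetic_three_prop38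
    (h3 : realPeriodRat_eq_unit_mul_plusPeriod_three)
    (A : WeierstrassCurve ℚ) [A.IsElliptic] [A.IsGloballyMinimal] [Fact (Nat.Prime 3)]
    (hgood : A.HasGoodReductionAtPrime 3) (hord : ¬ ((3 : ℕ) : ℤ) ∣ A.frobeniusTrace 3)
    (hirr : A.HasIrreducibleModPGaloisRep 3)
    (hna : ¬ 3 ∣ A.reductionPointCount 3) (htam : ¬ 3 ∣ A.tamagawaProduct)
    (hL : ∃ q : ℚ, q ≠ 0 ∧ A.entireLFunction 1 / (A.realPeriodRat : ℂ) = (q : ℂ) ∧ padicValRat 3 q = 0)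
    (hSel : Nat.card (A.selmerGroupPInfty 3) = 1) :
    ∀ (κ : ZpExtension ℚ 3) (γ : Field.absoluteGaloisGroup ℚ),
        κ.IsCyclotomic → κ.IsTopGenerator γ → IsCyclotomicVariable 3 γ →
      ∀ [NeZero (A.conductorNorm ℤ)] (fA : CuspForm (Gamma0 (A.conductorNorm ℤ)) 2),
        IsNewformOf A fA → ∀ (ϖ : ℚ), (ϖ : ℝ) * A.realPeriodRat = plusPeriod fA →
      ∀ (D : A.SelmerDualData κ γ), D.IsTorsion ∧
        ∃ g : IwasawaAlgebra 3, D.charIdeal = Ideal.span {g} ∧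
          GreenbergVatsal2000.HasUnitContent g ∧
          iwasawaToPowerSeries 3 g =
            PowerSeries.C (ϖ : ℚ_[3]) * padicLFunction fA (unitRoot A 3 : ℚ_[3]) := by
  intro κ γ hκ hγ _ _ fA hf ϖ hϖeq D
  haveI := subsingleton_dualSelmer_of_trivialArithmetic A 3 hgood hord hna htam hSel hκ hγ D
  exact ⟨Iwasawa.isTorsion_of_subsingleton D,
    exists_unitGenerator_of_charIdeal_eq_top A 3 (by decide) hgood hord hirr hna hL fA hf ϖ
      (norm_periodRatio_eq_one_three h3 A hgood hirr fA hf ϖ hϖeq) hϖeq D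
      (Iwasawa.charIdeal_eq_top_of_subsingleton D)⟩

/-- **Hence the cell's typed missing input X_A3 at the pair, `MazurMainConjecture A 3`, for a curve
with trivial `3`-primary arithmetic — named fact `h3` only** (unit-content clause dropped).
[cite: GreenbergLNM1716, §3 Prop. 3.8 and Remark (pp. 95–96)] [cite: CastellaGrossiSkinner2025, Introduction (MC)] -/
theorem mazurMainConjecture_three_prop38 (h3 : realPeriodRat_eq_unit_mul_plusPeriod_three)
    (A : WeierstrassCurve ℚ) [A.IsElliptic] [A.IsGloballyMinimal] [Fact (Nat.Prime 3)]
    (hgood : A.HasGoodReductionAtPrime 3) (hord : ¬ ((3 : ℕ) : ℤ) ∣ A.frobeniusTrace 3)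
    (hirr : A.HasIrreducibleModPGaloisRep 3)
    (hna : ¬ 3 ∣ A.reductionPointCount 3) (htam : ¬ 3 ∣ A.tamagawaProduct)
    (hL : ∃ q : ℚ, q ≠ 0 ∧ A.entireLFunction 1 / (A.realPeriodRat : ℂ) = (q : ℂ) ∧ padicValRat 3 q = 0)
    (hSel : Nat.card (A.selmerGroupPInfty 3) = 1) :
    MazurMainConjecture A 3 := by
  intro κ γ hκ hγ hγ' _ f hf ϖ hϖ D
  obtain ⟨hT, g, hg, -, hι⟩ := mazurMainConjecture_with_mu_zero_of_trivialArithmetic_three_prop38 h3 A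
    hgood hord hirr hna htam hL hSel κ γ hκ hγ hγ' f hf ϖ hϖ D
  exact ⟨hT, g, hg, hι⟩

end Summit.BirchSwinnertonDyer.Rank1Residual.X10.UnitRoad
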